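import Literature.Analysis.FluidPDE.BarkerPrangeConcentrationProofs
import Literature.Analysis.FluidPDE.LerayHopfRegularRestart
import HarnessLib

/-!
# Barker–Prange 2020: Theorem 2 follows from Theorem 1

Analysis/FluidPDE proof file (one theorem, no definitions, no named facts) completing the
reduction of the named fact `Literature.Analysis.FluidPDE.BarkerPrange2020_thm2`
(`BarkerPrangeConcentration.lean`; T. Barker, C. Prange, Arch. Ration. Mech. Anal. 236 (2020)
= arXiv:1812.09115, **Theorem 2**) to the paper's **Theorem 1** alone.

`BarkerPrange2020_thm2_of_localizedSmoothing` (`BarkerPrangeConcentrationProofs.lean`) formalises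
the printed proof of Theorem 2 (§4.2) over two hypotheses: `hT1`, Theorem 1 in the slab form in
which §4.2 uses it, and `hLE`, the restarting of the Leray–Hopf solution — regular on the open
strip before its first blow-up time — as a local energy solution, which §4.2 uses tacitly when
it applies Theorem 1 to `u_λ` "with initial data `u_λ(·, 0)`". The second hypothesis is now a
theorem of the tree, `IsGlobalLerayHopf.exists_isLocalEnergySolutionOn_restart`
(`LerayHopfRegularRestart.lean`: associated pressure of a Leray–Hopf solution, suitability from
local essential boundedness, interior continuity at regular points, identification of every
slice of the weakly continuous solution, decay at infinity). Hence:

* `BarkerPrange2020_thm2_of_thm1 : hT1 → BarkerPrange2020_thm2`.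

What remains below `BarkerPrange2020_thm2`: exactly `hT1` = Barker–Prange 2020, **Theorem 1**
(localized smoothing for local energy solutions with locally critical `L³` data; the paper's main
theorem, §§2–4 = Kang–Miura–Tsai, IMRN 2021, Thm. 1.1 / Cor. 1.2), which is not in the tree.

## References

* T. Barker, C. Prange, Arch. Ration. Mech. Anal. 236 (2020) 1487–1541 = arXiv:1812.09115:
  Thm. 1 (p. 2), Thm. 2 (pp. 4–5), §4.2 (p. 16), Def. 16 (p. 17). [BarkerPrange2020]
* K. Kang, H. Miura, T.-P. Tsai, IMRN 2021 = arXiv:1812.10509, Thm. 1.1, Cor. 1.2.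
  [KangMiuraTsai2020]
-/

noncomputable section

open MeasureTheory Set Function Filter Metric
open scoped ENNReal NNReal

namespace Literature.Analysis.FluidPDE

/-- **Barker–Prange 2020, Theorem 2 from Theorem 1.** If Theorem 1 of the paper holds in the
slab form used by its §4.2 — there are a universal `γ > 0` and, for every `M > 0`, a time
`S = S*(M) ∈ (0, ¼]` such that every local energy solution `(v, π)` on `ℝ³ × (0, S)` with unit
viscosity (`IsLocalEnergySolutionOn S 1 v₀ v π`, Seregin 2014 Def. B.1 = the paper's Def. 16 on
the finite strip) whose datum lies in `E²` (`MemE2`) with `‖v₀‖_{L²(B₁(x̄))} ≤ M` for all `x̄` and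
`‖v₀‖_{L³(B₂(0))} ≤ γ` is essentially bounded on `(β, S) × B_{1/3}(0)` for every `β ∈ (0, S)` —
then Theorem 2 (`BarkerPrange2020_thm2`: `L³` concentration at the similarity scale near a
Type-I singularity of a Leray–Hopf solution first blowing up at `T`) holds. The printed proof
(§4.2) is `BarkerPrange2020_thm2_of_localizedSmoothing`; its restarting step is
`IsGlobalLerayHopf.exists_isLocalEnergySolutionOn_restart`.
[cite: BarkerPrange2020, Thm. 2 with its proof §4.2 (arXiv:1812.09115 pp. 4–5, 16) and Thm. 1 (p. 2)] -/
theorem BarkerPrange2020_thm2_of_thm1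
    (hT1 : ∃ γ : ℝ, 0 < γ ∧ ∀ M : ℝ, 0 < M → ∃ S : ℝ, 0 < S ∧ S ≤ 1 / 4 ∧
      ∀ (v₀ : EuclideanSpace ℝ (Fin 3) → EuclideanSpace ℝ (Fin 3))
        (v : ℝ → EuclideanSpace ℝ (Fin 3) → EuclideanSpace ℝ (Fin 3))
        (π : ℝ → EuclideanSpace ℝ (Fin 3) → ℝ),
        IsLocalEnergySolutionOn S 1 v₀ v π → MemE2 v₀ →
        (∀ x₁ : EuclideanSpace ℝ (Fin 3),
          eLpNorm v₀ 2 (volume.restrict (ball x₁ 1)) ≤ ENNReal.ofReal M) →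
        eLpNorm v₀ 3 (volume.restrict (ball (0 : EuclideanSpace ℝ (Fin 3)) 2)) ≤ ENNReal.ofReal γ →
        ∀ β ∈ Ioo 0 S, eLpNorm (uncurry v) ∞
          (volume.restrict (Ioo β S ×ˢ ball (0 : EuclideanSpace ℝ (Fin 3)) (1 / 3))) < ∞) :
    BarkerPrange2020_thm2 :=
  BarkerPrange2020_thm2_of_localizedSmoothing hT1
    fun _ν hν _u₀ _u hLH _T hT hreg _t ht => hLH.exists_isLocalEnergySolutionOn_restart hν hT hreg ht

end Literature.Analysis.FluidPDE

end
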